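import Summits.BirchSwinnertonDyer.BirchSwinnertonDyer.Theorems.EisensteinPrimesBSDpOnCellCTelescopeK2InertiaFrobeniusAnnihilatorBranch
import Summits.BirchSwinnertonDyer.BirchSwinnertonDyer.Theorems.EisensteinPrimesBSDpOnCellCTelescopeK2FixedTorsionFiniteMult
import Summits.BirchSwinnertonDyer.BirchSwinnertonDyer.Theorems.EisensteinPrimesBSDpOnCellCTelescopeK2InertiaMovesRootsOfUnity
import Summits.BirchSwinnertonDyer.Rank1Residual.X2.Cells
import Summits.BirchSwinnertonDyer.Rank1Residual.X11b.AnticyclotomicEmbedding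
import HarnessLib

/-!
# Crux 4 `BSDpOnCellC` (stmt-BirchSwinnertonDyer-19034), line `telescope`, leaf N2 / sub-leaf W2: W2's CONTROL MAP ON ALL OF CELL C —
# `∃ α : X^∅_𝔭bar/(C X) → Sel(M₂[C X])^∨` from N1's fibre data + `Mult` (split OR non-split) [+ Heegner], with (ann) DISCHARGED and the
# (split) hypothesis of p749092 / p752662 REPLACED by multiplicative reduction — NO residual local hypothesis
# (helper, `--supports stmt-BirchSwinnertonDyer-19034 --as helper`; closes nothing; NOT the registered text)

Cell `bsd-eis`, width seat `bsd-line-x2-p2` (prover g20, 2026-08-30; D-0154 KEY row 5). THEOREMS ONLY: no definition, no named fact,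
no `sorry`, no instance, no notation. The proof of width g19's `TelescopeK2WeightTwoControlMapOfFrobenius.exists_weightTwoControlMap_of_frobenius_of_split`
(p752662) re-run with TWO inputs replaced by this seat's theorems:
* (hfin𝔭bar)/(hfinK) from `TelescopeK2FixedTorsionFiniteMult.finite_fixed_torsionBy_local_of_mult` (twisted Tate uniformisation; split OR
  non-split) instead of `TelescopeK2FixedTorsionFiniteSplitMult` (split only); its local hypothesis (μ) «no primitive `p`-th root of unity of
  `K̄_𝔭bar` is fixed by `I_{K_𝔭bar}`» is DISCHARGED at the degree-one prime `𝔭bar` by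
  `TelescopeK2InertiaMovesRootsOfUnity.eq_one_of_pow_prime_eq_one_of_forall_absInertia` (`ℚ_p(ζ_p)/ℚ_p` ramified, `p ≠ 2`);
* (ann) from `TelescopeK2InertiaFrobeniusAnnihilatorBranch.exists_monic_frobeniusAnnihilator_of_fibreData` (cofinite generation of
  `H¹(I_w, A₂[X])` + Cayley–Hamilton) instead of a hypothesis.

* **`exists_weightTwoControlMap_of_mult`** — `K` imaginary quadratic, `p ≠ 2`, `κ` anticyclotomic, `𝔭bar ∋ p` of degree one, `E = W/ℚ` with
  MULTIPLICATIVE reduction at `p`, `ρ₂ : Γ_K → Aut_{ℤ_p⟦X⟧}(A₂)` with (tor), (cof₀), (unr `S₀`), (fd₀ `θ₀`, finite kernel), (deg₁):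
  `∃ α : QuotSMulTop (C X) (XBig κ ρ₂ 𝔭bar ∅) →ₗ Sel(M₂[C X])^∨` with kernel killed elementwise by scalars prime to `C X` and FINITE cokernel.
* **`exists_weightTwoControlMap_of_mult_of_heegner`** — the same with (deg₁) from `SatisfiesHeegnerHypothesis N₀ K` + «bad `w ∤ p` divide `N₀`».
* **`exists_weightTwoControlMap_of_cellC`** — the same in the BINDER CURRENCY of the N2 workfile's `K2Weight2.stub_weightTwoControlMap` (v10):
  `CellC W p`, `IsImaginaryQuadratic K`, `SatisfiesHeegnerHypothesis N K`, `p` split in `K` (`ncard (primesOver p) = 2`), `𝔭bar ∋ p`, and N1's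
  (unr) as `∃`-free data `S₀ : Set`, `S₀.Finite`, `IsUnramifiedOutside S₀ ρ₂` PLUS the one clause W2's text does not carry:
  «`∀ w ∈ S₀, w ∤ p → N ∈ w`» (the branch lattice is unramified outside `Np`) — see the FINDING in the HONEST FRAMING.

NET FOR W2 (by name): on Cell C (`Mult W p`, both signs) with the road prefix (`K` imaginary quadratic, `p` odd, `κ` anticyclotomic, `𝔭bar`
of degree one, Heegner for `N₀`), W2's conclusion follows from N1-SHAPED fibre data ALONE — no (split), no (inert), no (ann), no (μ).

FINDING (for the LEAD): W2's registered-workfile text quantifies N1's (unr) as `∃ S₀ finite, IsUnramifiedOutside S₀ ρ₂` with NO link between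
`S₀` and `N`; the control argument needs (deg₁) «every `w ∈ S₀`, `w ∤ p`, has `e = f = 1`» (finitely decomposed in `K_∞`), which the Heegner
hypothesis supplies exactly for `w ∣ N` — an `S₀` containing an INERT prime is not excluded by the typed FD, and there the local defect need not
be `Λ`-cotorsion (W2's own «Why it might fail»). Recommended repair (N1 side, loss-free for the true branch lattice, unramified outside `Np`):
type (unr) as `∃ S₀, S₀.Finite ∧ IsUnramifiedOutside S₀ ρ₂ ∧ ∀ w ∈ S₀, p ∉ w → N ∈ w`; then `exists_weightTwoControlMap_of_cellC` IS W2.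

HONEST FRAMING: assembly over binders; the branch lattice `ρ₂` is a binder; nothing about any curve's BSD is proved;
no registered stub, crux or summit statement is proved by this file; closes: none.

References: [JetchevSkinnerWan2017] §3.4 Lemma 3.4.1; [Castella2018Erratum] Lemma 2.1 (p. 2); [SilvermanATAEC1994] Thm. V.5.3, Cor. V.5.4;
[Brink2007] Thm. 2, Cor. 1 (pp. 2134–2136); [Gross1991] §1; [GreenbergVatsal2000] Prop. 2.4; [SerreLocalFields1979] Ch. IV §4 Prop. 17–18.
-/

noncomputable section

-- D-0017: single-problem summit, the namespace repeats the problem name by design.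
set_option linter.dupNamespace false
set_option autoImplicit false

open Field IsDedekindDomain NumberField WeierstrassCurve
open Literature.NumberTheory.GaloisRepresentations Literature.NumberTheory.EllipticCurves
  Literature.NumberTheory.EllipticCurves.BigRepModule Literature.NumberTheory.EllipticCurves.BigGaloisRep
open Summit.BirchSwinnertonDyer.Rank1Residual.X11b

namespace Summit.BirchSwinnertonDyer.BirchSwinnertonDyer.Theorems.TelescopeK2WeightTwoControlMapOfMult

variable {K : Type} [Field K] [NumberField K] {p : ℕ} [Fact p.Prime]

/-- **SUB-LEAF W2 FROM FIBRE DATA ON ALL OF CELL C: `Mult` (split OR non-split) + (deg₁); (ann) and (μ) discharged.** See the module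
docstring; the proof is p752662's, with `TelescopeK2FixedTorsionFiniteMult.finite_fixed_torsionBy_local_of_mult` for the finite fixed torsion at
`𝔭bar` and `TelescopeK2InertiaFrobeniusAnnihilatorBranch.exists_monic_frobeniusAnnihilator_of_fibreData` for the Frobenius annihilators.
[cite: JetchevSkinnerWan2017, §3.4, Lemma 3.4.1 (arXiv:1512.06894 p. 14)] [cite: Castella2018Erratum, Lemma 2.1 (p. 2)]
[cite: SilvermanATAEC1994, Thm. V.5.3, Cor. V.5.4 (PDF pp. 407–410)] [cite: Brink2007, Thm. 2 and Cor. 1 (pp. 2134–2136)] -/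
theorem exists_weightTwoControlMap_of_mult
    (W : WeierstrassCurve ℚ) [W.IsElliptic] (hK : IsImaginaryQuadratic K) (hp2 : p ≠ 2)
    (hmult : W.HasMultiplicativeReductionAtPrime p)
    (κ : ZpExtension K p) (hκ : κ.IsAnticyclotomic)
    (𝔭bar : HeightOneSpectrum (𝓞 K)) (h𝔭bar : ((p : ℕ) : 𝓞 K) ∈ 𝔭bar.asIdeal)
    (he : 𝔭bar.asIdeal.ramificationIdx (𝓞 ℚ) = 1) (hf : 𝔭bar.asIdeal.inertiaDeg (𝓞 ℚ) = 1)
    [TopologicalSpace (PowerSeries ℤ_[p])] (A₂ : Type) [AddCommGroup A₂] [Module (PowerSeries ℤ_[p]) A₂]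
    [TopologicalSpace A₂] [DiscreteTopology A₂]
    (ρ₂ : ContinuousRep (absoluteGaloisGroup K) (PowerSeries ℤ_[p]) A₂)
    [TopologicalSpace (PowerSeries (PowerSeries ℤ_[p]))]
    [ContinuousSMul (PowerSeries (PowerSeries ℤ_[p])) (BigRepModule (PowerSeries ℤ_[p]) p A₂)]
    -- (tor), (cof₀), (unr), (fd₀) of N1's fibre data
    (htor : ∀ a : A₂, ∃ n : ℕ, (PowerSeries.X : PowerSeries ℤ_[p]) ^ n • a = 0)
    (hcof : ∀ a : A₂, ∃ b : A₂, (PowerSeries.X : PowerSeries ℤ_[p]) • b = a)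
    (S₀ : Finset (HeightOneSpectrum (𝓞 K))) (hunr : GaloisRep.IsUnramifiedOutside (S₀ : Set (HeightOneSpectrum (𝓞 K))) ρ₂)
    (θ₀ : Submodule.torsionBy (PowerSeries ℤ_[p]) A₂ (PowerSeries.X : PowerSeries ℤ_[p]) →+
      PrimaryTorsion (W.baseChange K).geomPoints p)
    (hθσ : ∀ (σ : absoluteGaloisGroup K)
      (a : Submodule.torsionBy (PowerSeries ℤ_[p]) A₂ (PowerSeries.X : PowerSeries ℤ_[p])),
      θ₀ (BigGaloisRep.torsionRep ρ₂ (PowerSeries.X : PowerSeries ℤ_[p]) σ a) =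
        (W.baseChange K).primaryTorsionGaloisRep p σ (θ₀ a))
    (hker : Finite θ₀.ker)
    -- (deg₁): the bad primes away from `p` have degree one (Heegner)
    (hdeg : ∀ w ∈ S₀, ((p : ℕ) : 𝓞 K) ∉ w.asIdeal →
      w.asIdeal.ramificationIdx (𝓞 ℚ) = 1 ∧ w.asIdeal.inertiaDeg (𝓞 ℚ) = 1) :
    ∃ α : QuotSMulTop (PowerSeries.C (PowerSeries.X : PowerSeries ℤ_[p])) (XBig κ ρ₂ 𝔭bar (∅ : Set (HeightOneSpectrum (𝓞 K))))
        →ₗ[PowerSeries (PowerSeries ℤ_[p])]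
        CharacterModule (TorsionControl.selmer (localMap K) (strictSet p 𝔭bar (∅ : Set (HeightOneSpectrum (𝓞 K))))
          (TorsionControl.torsionRep (AnticyclotomicBigGaloisRep κ ρ₂) (PowerSeries.C (PowerSeries.X : PowerSeries ℤ_[p])))),
      (∀ m ∈ LinearMap.ker α, ∃ s : PowerSeries (PowerSeries ℤ_[p]),
        ¬ ((PowerSeries.C (PowerSeries.X : PowerSeries ℤ_[p])) ∣ s) ∧ s • m = 0) ∧
      Finite ((CharacterModule (TorsionControl.selmer (localMap K) (strictSet p 𝔭bar (∅ : Set (HeightOneSpectrum (𝓞 K))))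
        (TorsionControl.torsionRep (AnticyclotomicBigGaloisRep κ ρ₂) (PowerSeries.C (PowerSeries.X : PowerSeries ℤ_[p]))))) ⧸
          LinearMap.range α) := by
  classical
  -- torsion and `p`-primarity of `A₂` from (tor) + (fd₀)
  have hPT : ∀ e : PrimaryTorsion (W.baseChange K).geomPoints p, IsOfFinAddOrder e := fun e => by
    obtain ⟨k, hk⟩ := PrimaryTorsion.exists_pow_smul_eq_zero e
    refine (isOfFinAddOrder_iff_nsmul_eq_zero).2 ⟨p ^ k, pow_pos (Nat.Prime.pos Fact.out) k, ?_⟩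
    apply PrimaryTorsion.ext
    rw [PrimaryTorsion.val_nsmul, hk, PrimaryTorsion.val_zero]
  have htors : ∀ a : A₂, IsOfFinAddOrder a :=
    TelescopeK2BigRepDivisible.isOfFinAddOrder_of_pow_torsion PowerSeries.X htor
      (TelescopeK2BigRepDivisible.isOfFinAddOrder_of_torsionBy PowerSeries.X θ₀ hker hPT)
  have hprim : ∀ a : A₂, ∃ k : ℕ, p ^ k • a = 0 := fun a =>
    TelescopeK2WeightTwoControlMapOfFrobenius.exists_pow_smul_eq_zero_of_isOfFinAddOrder (htors a)
  have hroot : ∀ a : A₂, (∃ k : ℕ, p ^ k • a = 0) →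
      ∃ b : A₂, (∃ k : ℕ, p ^ k • b = 0) ∧ (PowerSeries.X : PowerSeries ℤ_[p]) • b = a :=
    TelescopeK2BigRepDivisible.exists_primaryRoot_of_divisible PowerSeries.X hcof htors
  -- the open image at `𝔭bar` and the two finite fixed sets (MULTIPLICATIVE, split or non-split)
  obtain ⟨s, hsurj⟩ :=
    AnticyclotomicLocalImage.anticyclotomic_exists_forall_exists_toAdd_eq_pow_mul hK hp2 κ hκ 𝔭bar h𝔭bar
  -- (μ) at the degree-one prime `𝔭bar` (this seat's `TelescopeK2InertiaMovesRootsOfUnity`)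
  have hμ : ∀ ζ : AlgebraicClosure (𝔭bar.adicCompletion K),
      (∀ σ ∈ absInertia (𝔭bar.adicCompletion K), σ • ζ = ζ) → ζ ^ p = 1 → ζ = 1 := fun ζ hfix hζ =>
    TelescopeK2InertiaMovesRootsOfUnity.eq_one_of_pow_prime_eq_one_of_forall_absInertia hp2 𝔭bar h𝔭bar he hf ζ hfix hζ
  have hfinloc := TelescopeK2FixedTorsionFiniteMult.finite_fixed_torsionBy_local_of_mult W κ ρ₂ PowerSeries.X θ₀
    hp2 hmult 𝔭bar h𝔭bar he hf hsurj hμ hθσ hker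
  have hfinK := TelescopeK2FixedTorsionFiniteSplitMult.finite_fixed_torsionBy_global_of_local κ ρ₂ PowerSeries.X 𝔭bar hfinloc
  -- the Frobenius annihilators at EVERY `w ∤ p` ((ann), this seat's #2)
  have hann := fun (w : HeightOneSpectrum (𝓞 K)) (hw : ((p : ℕ) : 𝓞 K) ∉ w.asIdeal) (d : LocalGroup K (Sum.inl w)) =>
    TelescopeK2InertiaFrobeniusAnnihilatorBranch.exists_monic_frobeniusAnnihilator_of_fibreData W A₂ ρ₂ htor hcof θ₀ hker w hw d
  -- the bad primes away from `p`, their Frobenius-type elements `d₀ w` with `κ(d₀ w) = p^{s_w} = N w`, and the annihilators `P w`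
  set S₁ : Finset (HeightOneSpectrum (𝓞 K)) := S₀.filter (fun w => ((p : ℕ) : 𝓞 K) ∉ w.asIdeal) with hS₁
  have hmem : ∀ w ∈ S₁, w ∈ S₀ ∧ ((p : ℕ) : 𝓞 K) ∉ w.asIdeal := fun w hw => Finset.mem_filter.1 hw
  have hd : ∀ w ∈ S₁, ∃ sd : ℕ × LocalGroup K (Sum.inl w),
      (κ (localMap K (Sum.inl w) sd.2)).toAdd = ((p ^ sd.1 : ℕ) : ℤ_[p]) := fun w hw => by
    obtain ⟨s', d, h⟩ := TelescopeK2WeightTwoControlMapOfFrobenius.exists_localMap_inl_toAdd_eq_pow hK κ hκ w (hmem w hw).2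
      ((hdeg w (hmem w hw).1 (hmem w hw).2).1) ((hdeg w (hmem w hw).1 (hmem w hw).2).2)
    exact ⟨(s', d), h⟩
  let d₀ : ∀ w : HeightOneSpectrum (𝓞 K), LocalGroup K (Sum.inl w) := fun w =>
    if hw : w ∈ S₁ then (Classical.choose (hd w hw)).2 else 1
  let N : HeightOneSpectrum (𝓞 K) → ℕ := fun w => if hw : w ∈ S₁ then p ^ (Classical.choose (hd w hw)).1 else 1
  have hN : ∀ w ∈ S₁, (κ (localMap K (Sum.inl w) (d₀ w))).toAdd = (N w : ℤ_[p]) := fun w hw => by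
    simp only [d₀, N, dif_pos hw]
    exact Classical.choose_spec (hd w hw)
  have hNpos : ∀ w ∈ S₁, 0 < N w := fun w hw => by
    simp only [N, dif_pos hw]
    exact pow_pos (Nat.Prime.pos Fact.out) _
  have hPex : ∀ w ∈ S₁, ∃ P : Polynomial (PowerSeries ℤ_[p]), P.Monic ∧
      ∀ a : A₂, (∀ h : LocalGroup K (Sum.inr w), ρ₂ (localMap K (Sum.inr w) h) a = a) →
        ∃ a₀ : A₂, (∀ h : LocalGroup K (Sum.inr w), ρ₂ (localMap K (Sum.inr w) h) a₀ = a₀) ∧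
          (PowerSeries.X : PowerSeries ℤ_[p]) • a₀ = (Polynomial.aeval (ρ₂ (localMap K (Sum.inl w) (d₀ w))) P) a :=
    fun w hw => hann w (hmem w hw).2 (d₀ w)
  let P : HeightOneSpectrum (𝓞 K) → Polynomial (PowerSeries ℤ_[p]) := fun w =>
    if hw : w ∈ S₁ then Classical.choose (hPex w hw) else Polynomial.X
  have hPmon : ∀ w ∈ S₁, (P w).Monic := fun w hw => by
    simp only [P, dif_pos hw]
    exact (Classical.choose_spec (hPex w hw)).1
  have hP : ∀ w ∈ S₁, ∀ a : A₂, (∀ h : LocalGroup K (Sum.inr w), ρ₂ (localMap K (Sum.inr w) h) a = a) →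
      ∃ a₀ : A₂, (∀ h : LocalGroup K (Sum.inr w), ρ₂ (localMap K (Sum.inr w) h) a₀ = a₀) ∧
        (PowerSeries.X : PowerSeries ℤ_[p]) • a₀ = (Polynomial.aeval (ρ₂ (localMap K (Sum.inl w) (d₀ w))) (P w)) a :=
    fun w hw => by
    simp only [P, dif_pos hw]
    exact (Classical.choose_spec (hPex w hw)).2
  refine TelescopeK2ControlOfFrobeniusData.exists_quotSMulTop_XBig_linearMap_of_frobeniusData κ ρ₂ 𝔭bar ∅
    PowerSeries.X (fun a _ => htor a) hroot hfinK hsurj hfinloc S₁ ?_ d₀ N hN P hP ?_ ?_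
  · -- (hunr) off `S₁`: a strict-set index `Sum.inr w` has `w ∤ p`, so `w ∉ S₁ ⇒ w ∉ S₀ ⇒` unramified
    intro w hw hstrict τ a
    have hpw : ((p : ℕ) : 𝓞 K) ∉ w.asIdeal := ((inr_mem_strictSet_iff p 𝔭bar w (∅ : Set (HeightOneSpectrum (𝓞 K)))).1 hstrict).2
    have hwS₀ : w ∉ (S₀ : Set (HeightOneSpectrum (𝓞 K))) := fun h =>
      hw (Finset.mem_filter.2 ⟨Finset.mem_coe.1 h, hpw⟩)
    exact TelescopeK2WeightTwoControlMapOfInert.apply_localMap_inr_eq_self_of_isUnramifiedAt ρ₂ (hunr w hwS₀) τ a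
  · -- (hrootsI): every element of `A₂` is `p`-primary
    rintro w - a - - ⟨a₀, ha₀, hc⟩
    exact ⟨a₀, ha₀, hprim a₀, hc⟩
  · -- (hnd): reduce modulo `X` (`constantCoeff : ℤ_p⟦X⟧ → ℤ_p`)
    intro a
    refine TelescopeK2WeightTwoControlMapOfFrobenius.not_C_dvd_C_mul_prod_aeval (PowerSeries.constantCoeff (R := ℤ_[p]))
      PowerSeries.constantCoeff_X ?_ S₁ N P hNpos hPmon
    rw [map_pow, map_natCast]
    exact pow_ne_zero _ (Nat.cast_ne_zero.2 (Nat.Prime.ne_zero Fact.out))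

/-- **SUB-LEAF W2 ON ALL OF CELL C UNDER THE HEEGNER HYPOTHESIS**: `exists_weightTwoControlMap_of_mult` with (deg₁) discharged from
`SatisfiesHeegnerHypothesis N₀ K` and «every bad prime away from `p` divides `N₀`» (tree
`ramificationIdx_eq_one_and_inertiaDeg_eq_one_of_natCast_mem_of_satisfiesHeegnerHypothesis`). No non-FD, non-road-prefix input remains.
[cite: Gross1991, §1 (the Heegner hypothesis)] [cite: Brink2007, Thm. 2 and Cor. 1 (pp. 2134–2136)]
[cite: SilvermanATAEC1994, Thm. V.5.3, Cor. V.5.4] [cite: JetchevSkinnerWan2017, §3.4, Lemma 3.4.1] -/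
theorem exists_weightTwoControlMap_of_mult_of_heegner
    (W : WeierstrassCurve ℚ) [W.IsElliptic] (hK : IsImaginaryQuadratic K) (hp2 : p ≠ 2)
    (hmult : W.HasMultiplicativeReductionAtPrime p)
    (κ : ZpExtension K p) (hκ : κ.IsAnticyclotomic)
    (𝔭bar : HeightOneSpectrum (𝓞 K)) (h𝔭bar : ((p : ℕ) : 𝓞 K) ∈ 𝔭bar.asIdeal)
    (he : 𝔭bar.asIdeal.ramificationIdx (𝓞 ℚ) = 1) (hf : 𝔭bar.asIdeal.inertiaDeg (𝓞 ℚ) = 1)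
    [TopologicalSpace (PowerSeries ℤ_[p])] (A₂ : Type) [AddCommGroup A₂] [Module (PowerSeries ℤ_[p]) A₂]
    [TopologicalSpace A₂] [DiscreteTopology A₂]
    (ρ₂ : ContinuousRep (absoluteGaloisGroup K) (PowerSeries ℤ_[p]) A₂)
    [TopologicalSpace (PowerSeries (PowerSeries ℤ_[p]))]
    [ContinuousSMul (PowerSeries (PowerSeries ℤ_[p])) (BigRepModule (PowerSeries ℤ_[p]) p A₂)]
    (htor : ∀ a : A₂, ∃ n : ℕ, (PowerSeries.X : PowerSeries ℤ_[p]) ^ n • a = 0)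
    (hcof : ∀ a : A₂, ∃ b : A₂, (PowerSeries.X : PowerSeries ℤ_[p]) • b = a)
    (S₀ : Finset (HeightOneSpectrum (𝓞 K))) (hunr : GaloisRep.IsUnramifiedOutside (S₀ : Set (HeightOneSpectrum (𝓞 K))) ρ₂)
    (θ₀ : Submodule.torsionBy (PowerSeries ℤ_[p]) A₂ (PowerSeries.X : PowerSeries ℤ_[p]) →+
      PrimaryTorsion (W.baseChange K).geomPoints p)
    (hθσ : ∀ (σ : absoluteGaloisGroup K)
      (a : Submodule.torsionBy (PowerSeries ℤ_[p]) A₂ (PowerSeries.X : PowerSeries ℤ_[p])),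
      θ₀ (BigGaloisRep.torsionRep ρ₂ (PowerSeries.X : PowerSeries ℤ_[p]) σ a) =
        (W.baseChange K).primaryTorsionGaloisRep p σ (θ₀ a))
    (hker : Finite θ₀.ker)
    {N₀ : ℕ} (hN0 : N₀ ≠ 0) (hHeeg : SatisfiesHeegnerHypothesis N₀ K)
    (hS₀N : ∀ w ∈ S₀, ((p : ℕ) : 𝓞 K) ∉ w.asIdeal → ((N₀ : ℕ) : 𝓞 K) ∈ w.asIdeal) :
    ∃ α : QuotSMulTop (PowerSeries.C (PowerSeries.X : PowerSeries ℤ_[p])) (XBig κ ρ₂ 𝔭bar (∅ : Set (HeightOneSpectrum (𝓞 K))))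
        →ₗ[PowerSeries (PowerSeries ℤ_[p])]
        CharacterModule (TorsionControl.selmer (localMap K) (strictSet p 𝔭bar (∅ : Set (HeightOneSpectrum (𝓞 K))))
          (TorsionControl.torsionRep (AnticyclotomicBigGaloisRep κ ρ₂) (PowerSeries.C (PowerSeries.X : PowerSeries ℤ_[p])))),
      (∀ m ∈ LinearMap.ker α, ∃ s : PowerSeries (PowerSeries ℤ_[p]),
        ¬ ((PowerSeries.C (PowerSeries.X : PowerSeries ℤ_[p])) ∣ s) ∧ s • m = 0) ∧
      Finite ((CharacterModule (TorsionControl.selmer (localMap K) (strictSet p 𝔭bar (∅ : Set (HeightOneSpectrum (𝓞 K))))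
        (TorsionControl.torsionRep (AnticyclotomicBigGaloisRep κ ρ₂) (PowerSeries.C (PowerSeries.X : PowerSeries ℤ_[p]))))) ⧸
          LinearMap.range α) :=
  exists_weightTwoControlMap_of_mult W hK hp2 hmult κ hκ 𝔭bar h𝔭bar he hf A₂ ρ₂ htor hcof S₀ hunr θ₀ hθσ hker
    (fun w hw hpw => ramificationIdx_eq_one_and_inertiaDeg_eq_one_of_natCast_mem_of_satisfiesHeegnerHypothesis hK.1 hHeeg hN0 w
      (hS₀N w hw hpw))

/-- **SUB-LEAF W2 IN THE ROAD-PREFIX CURRENCY OF THE N2 WORKFILE** (`K2Weight2.stub_weightTwoControlMap`, telescope v10): from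
`CellC W p` (so `p ≠ 2` and `E` MULTIPLICATIVE at `p`, split or non-split), `K` imaginary quadratic satisfying the Heegner hypothesis for
`N`, `p` split in `K`, `κ` anticyclotomic, `𝔭bar ∋ p`, and N1's fibre data (tor)/(cof₀)/(unr `S₀`)/(fd₀) PLUS «`S₀ ∖ {w ∣ p} ⊆ {w ∣ N}`»:
W2's conclusion. No (split), (inert), (ann) or (μ) hypothesis. [cite: JetchevSkinnerWan2017, §3.4, Lemma 3.4.1 (arXiv:1512.06894 p. 14)]
[cite: Castella2018Erratum, Lemma 2.1 (p. 2)] [cite: SilvermanATAEC1994, Thm. V.5.3, Cor. V.5.4] [cite: Gross1991, §1] [cite: Brink2007, Cor. 1] -/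
theorem exists_weightTwoControlMap_of_cellC
    (W : WeierstrassCurve ℚ) [W.IsElliptic] [W.IsGloballyMinimal] (hc : Rank1Residual.X2.CellC W p)
    {N : ℕ} [NeZero N] (hK : IsImaginaryQuadratic K) (hHeeg : SatisfiesHeegnerHypothesis N K)
    (hsp : ((Ideal.span {(p : ℤ)}).primesOver (𝓞 K)).ncard = 2)
    (κ : ZpExtension K p) (hκ : κ.IsAnticyclotomic)
    (𝔭bar : HeightOneSpectrum (𝓞 K)) (h𝔭bar : ((p : ℕ) : 𝓞 K) ∈ 𝔭bar.asIdeal)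
    [TopologicalSpace (PowerSeries ℤ_[p])] (A₂ : Type) [AddCommGroup A₂] [Module (PowerSeries ℤ_[p]) A₂]
    [TopologicalSpace A₂] [DiscreteTopology A₂]
    (ρ₂ : ContinuousRep (absoluteGaloisGroup K) (PowerSeries ℤ_[p]) A₂)
    [TopologicalSpace (PowerSeries (PowerSeries ℤ_[p]))]
    [ContinuousSMul (PowerSeries (PowerSeries ℤ_[p])) (BigRepModule (PowerSeries ℤ_[p]) p A₂)]
    (htor : ∀ a : A₂, ∃ n : ℕ, (PowerSeries.X : PowerSeries ℤ_[p]) ^ n • a = 0)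
    (hcof : ∀ a : A₂, ∃ b : A₂, (PowerSeries.X : PowerSeries ℤ_[p]) • b = a)
    (S₀ : Set (HeightOneSpectrum (𝓞 K))) (hS₀ : S₀.Finite) (hunr : GaloisRep.IsUnramifiedOutside S₀ ρ₂)
    (hS₀N : ∀ w ∈ S₀, ((p : ℕ) : 𝓞 K) ∉ w.asIdeal → ((N : ℕ) : 𝓞 K) ∈ w.asIdeal)
    (θ₀ : Submodule.torsionBy (PowerSeries ℤ_[p]) A₂ (PowerSeries.X : PowerSeries ℤ_[p]) →+
      PrimaryTorsion (W.baseChange K).geomPoints p)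
    (hθσ : ∀ (σ : absoluteGaloisGroup K)
      (a : Submodule.torsionBy (PowerSeries ℤ_[p]) A₂ (PowerSeries.X : PowerSeries ℤ_[p])),
      θ₀ (BigGaloisRep.torsionRep ρ₂ (PowerSeries.X : PowerSeries ℤ_[p]) σ a) =
        (W.baseChange K).primaryTorsionGaloisRep p σ (θ₀ a))
    (hker : Finite θ₀.ker) :
    ∃ α : QuotSMulTop (PowerSeries.C (PowerSeries.X : PowerSeries ℤ_[p])) (XBig κ ρ₂ 𝔭bar (∅ : Set (HeightOneSpectrum (𝓞 K))))
        →ₗ[PowerSeries (PowerSeries ℤ_[p])]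
        CharacterModule (TorsionControl.selmer (localMap K) (strictSet p 𝔭bar (∅ : Set (HeightOneSpectrum (𝓞 K))))
          (TorsionControl.torsionRep (AnticyclotomicBigGaloisRep κ ρ₂) (PowerSeries.C (PowerSeries.X : PowerSeries ℤ_[p])))),
      (∀ m ∈ LinearMap.ker α, ∃ s : PowerSeries (PowerSeries ℤ_[p]),
        ¬ ((PowerSeries.C (PowerSeries.X : PowerSeries ℤ_[p])) ∣ s) ∧ s • m = 0) ∧
      Finite ((CharacterModule (TorsionControl.selmer (localMap K) (strictSet p 𝔭bar (∅ : Set (HeightOneSpectrum (𝓞 K))))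
        (TorsionControl.torsionRep (AnticyclotomicBigGaloisRep κ ρ₂) (PowerSeries.C (PowerSeries.X : PowerSeries ℤ_[p]))))) ⧸
          LinearMap.range α) := by
  classical
  -- `CellC = (r_an = 1) ∧ (p ≠ 2 ∧ Red ∧ Mult)`; `𝔭bar` has degree one because `p` splits in the quadratic field `K`
  have hp2 : p ≠ 2 := hc.2.1
  have hmult : W.HasMultiplicativeReductionAtPrime p := hc.2.2.2
  obtain ⟨he, hf⟩ := degreeOne_of_splitsIn hK.1 hsp h𝔭bar
  have hcoe : ((hS₀.toFinset : Finset (HeightOneSpectrum (𝓞 K))) : Set (HeightOneSpectrum (𝓞 K))) = S₀ := hS₀.coe_toFinset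
  exact exists_weightTwoControlMap_of_mult_of_heegner W hK hp2 hmult κ hκ 𝔭bar h𝔭bar he hf A₂ ρ₂ htor hcof hS₀.toFinset
    (by rw [hcoe]; exact hunr) θ₀ hθσ hker (NeZero.ne N) hHeeg (fun w hw hpw => hS₀N w (hS₀.mem_toFinset.1 hw) hpw)

end Summit.BirchSwinnertonDyer.BirchSwinnertonDyer.Theorems.TelescopeK2WeightTwoControlMapOfMult

end
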